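import Summits.KontsevichZagierPeriods.KontsevichZagierPeriods.Theses.HurwitzMicroSectors
import Summits.KontsevichZagierPeriods.KontsevichZagierPeriods.Theorems.HurwitzMicroSectorsNormalFormPrinciplePiBoxTransfer
import Summits.KontsevichZagierPeriods.KontsevichZagierPeriods.Theorems.HurwitzMicroSectorsNormalFormPrincipleVariants2215
import Summits.KontsevichZagierPeriods.KontsevichZagierPeriods.Theorems.HurwitzMicroSectorsNormalFormPrincipleVariants2283

/-! TTRL-lite variant V2252 of stmt-KontsevichZagierPeriods-3869

Variant V2252 = `stub_boxRigidity` (the leaf `BoxRigidity` of `NormalFormPrinciple`: two BOX-RATIONAL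
representations — domain the open unit box, integrand `p/q` over `ℚ` — with equal values are
KZ-equivalent) with BOTH dimensions frozen, `fix_nat:m=3; fix_nat:m'=5`. Verdict of the attempt seat:
**open** — this file is the exact-strength certificate, not a proof of the variant. A two-sided freeze
`(j, k)` of the leaf is exactly BoxVanishing in the LARGER dimension (`boxRigidityFix_iff_boxVanishing_snd`,
file `…Variants2215`: one way, compare a representation of value `0` on the `5`-box with the zero
representation on the `3`-box, which is box-rational of value `0` and itself a relation; the other way,
pad the `3`-dimensional representation to the `5`-box by unit intervals, `pad_le`, and subtract the
integrands on the common box, `sub_same`, rule 1b) — the difference has value `0` by soundness). Hence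
`V2252 ⟺ BoxVanishing 5` (`stub_boxRigidity_var2252_iff_boxVanishing_five`) `⟺ V2283`
(`fix m=5; m'=2`, `stub_boxRigidity_var2252_iff_var2283`) `⟺ BoxRigidity under the joint bound m, m' ≤ 5`
(`stub_boxRigidity_var2252_iff_le_five`): Conjecture 1 for the periods `∫_{(0,1)⁵} p/q` — among them
`ζ(5)`, `ζ(2)ζ(3)`, `π⁴ log 2`, all multiple zeta values of weight `≤ 5`, `Li₅`/Clausen values … — whose
`ℚ`-linear relations are not known (e.g. whether `ζ(5) ∈ ℚ·ζ(2)ζ(3)`), so no argument in the tree or the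
literature proves it; and `KontsevichZagierPeriods → V2252` (`stub_boxRigidity_var2252_of_statement`),
so a refutation of the variant would refute the Summit. In the sibling lattice
`parent ⇒ V2227 (BoxVanishing 6) ⇒ V2252 = V2283 = V2284 (BoxVanishing 5) ⇒ V2215 (BoxVanishing 4) ⇒ …`
(`stub_boxRigidity_var2215_of_var2252`, `boxVanishing_le_five_of_stub_boxRigidity_var2252`). (The
two-sided instances with both dimensions `≤ 1` are the theorem `boxRigidity_of_le_one`, by Baker;
dimension `2` is the first open one.)
Source: M. Kontsevich, D. Zagier, *Periods* (2001), §1.2 Conjecture 1 and rules 1)–3).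
Pure proof file, no definitions. -/

-- `Summit.<Summit>.<Problem>` is the tree's mandated summit-side namespace (CONVENTIONS §2); for this
-- single-conjunct summit the two coincide, so the duplicate is deliberate.
set_option linter.dupNamespace false

noncomputable section

namespace Summit.KontsevichZagierPeriods.KontsevichZagierPeriods.Theorems

open MeasureTheory Set
open Literature.NumberTheory.Transcendental Literature.NumberTheory.Transcendental.KZ
open Summit.KontsevichZagierPeriods.KontsevichZagierPeriods.Theses.HurwitzMicroSectors
open Summit.KontsevichZagierPeriods.HurwitzMicroSectors.NormalFormPrinciple.PiBox

/-! ## The variant V2252: Conjecture 1 for box-rational periods of dimension 5 -/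

/-- **V2252 ⟺ BoxVanishing in dimension `5`** (every box-rational representation on `(0,1)⁵` of
value `0` is a relation): instance `(j, k) = (3, 5)` of `boxRigidityFix_iff_boxVanishing_snd`.
[cite: KontsevichZagier2001, §1.2 Conjecture 1] -/
theorem stub_boxRigidity_var2252_iff_boxVanishing_five :
    (∀ (N : IntegralRep 3) (N' : IntegralRep 5), N.domain = {x | ∀ i, x i ∈ Set.Ioo (0:ℝ) 1} → N.IsRational → N'.domain = {x | ∀ i, x i ∈ Set.Ioo (0:ℝ) 1} → N'.IsRational → N.value = N'.value → Equivalent N N') ↔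
    (∀ N : IntegralRep 5, N.domain = {x | ∀ i, x i ∈ Set.Ioo (0:ℝ) 1} → N.IsRational →
      N.value = 0 → of N ∈ relations) :=
  boxRigidityFix_iff_boxVanishing_snd (by norm_num)

/-- **V2252 ⟺ V2283** (the mirror freeze `fix m=5; m'=2`): both are BoxVanishing in dimension `5`;
the smaller frozen dimension is idle. [cite: KontsevichZagier2001, §1.2 Conjecture 1] -/
theorem stub_boxRigidity_var2252_iff_var2283 :
    (∀ (N : IntegralRep 3) (N' : IntegralRep 5), N.domain = {x | ∀ i, x i ∈ Set.Ioo (0:ℝ) 1} → N.IsRational → N'.domain = {x | ∀ i, x i ∈ Set.Ioo (0:ℝ) 1} → N'.IsRational → N.value = N'.value → Equivalent N N') ↔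
    (∀ (N : IntegralRep 5) (N' : IntegralRep 2), N.domain = {x | ∀ i, x i ∈ Set.Ioo (0:ℝ) 1} → N.IsRational → N'.domain = {x | ∀ i, x i ∈ Set.Ioo (0:ℝ) 1} → N'.IsRational → N.value = N'.value → Equivalent N N') :=
  stub_boxRigidity_var2252_iff_boxVanishing_five.trans
    stub_boxRigidity_var2283_iff_boxVanishing_five.symm

/-- **V2252 ⟺ BoxRigidity under the joint bound `m, m' ≤ 5`** — strictly between the tree's theorem
`boxRigidity_of_le_one` (`m, m' ≤ 1`, Baker) and the full leaf; already the level `2` it contains is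
open. [cite: KontsevichZagier2001, §1.2 Conjecture 1] -/
theorem stub_boxRigidity_var2252_iff_le_five :
    (∀ (N : IntegralRep 3) (N' : IntegralRep 5), N.domain = {x | ∀ i, x i ∈ Set.Ioo (0:ℝ) 1} → N.IsRational → N'.domain = {x | ∀ i, x i ∈ Set.Ioo (0:ℝ) 1} → N'.IsRational → N.value = N'.value → Equivalent N N') ↔
    (∀ (m m' : ℕ) (N : IntegralRep m) (N' : IntegralRep m'), m ≤ 5 → m' ≤ 5 →
      N.domain = {x | ∀ i, x i ∈ Set.Ioo (0:ℝ) 1} → N.IsRational →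
      N'.domain = {x | ∀ i, x i ∈ Set.Ioo (0:ℝ) 1} → N'.IsRational →
      N.value = N'.value → Equivalent N N') :=
  stub_boxRigidity_var2252_iff_var2283.trans stub_boxRigidity_var2283_iff_le_five

/-- **V2252 ⇒ BoxVanishing in every dimension `≤ 5`** (BoxVanishing descends along padding); the
first open level is `2`: every `ℚ`-rational absolutely convergent `∫∫_{(0,1)²} p/q` of value `0` would be
a relation. [cite: KontsevichZagier2001, §1.2 Conjecture 1] -/
theorem boxVanishing_le_five_of_stub_boxRigidity_var2252
    (h : ∀ (N : IntegralRep 3) (N' : IntegralRep 5), N.domain = {x | ∀ i, x i ∈ Set.Ioo (0:ℝ) 1} → N.IsRational → N'.domain = {x | ∀ i, x i ∈ Set.Ioo (0:ℝ) 1} → N'.IsRational → N.value = N'.value → Equivalent N N')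
    {j : ℕ} (hj : j ≤ 5) (N : IntegralRep j) (hNd : N.domain = {x | ∀ i, x i ∈ Set.Ioo (0:ℝ) 1})
    (hNr : N.IsRational) (hv : N.value = 0) : of N ∈ relations :=
  boxVanishing_le_five_of_stub_boxRigidity_var2283 (stub_boxRigidity_var2252_iff_var2283.1 h)
    hj N hNd hNr hv

/-- **V2252 ⇒ V2215** (`fix m=2; m'=4`, i.e. BoxVanishing `4`): the sibling lattice is the chain of
dimensions. [cite: KontsevichZagier2001, §1.2 Conjecture 1] -/
theorem stub_boxRigidity_var2215_of_var2252
    (h : ∀ (N : IntegralRep 3) (N' : IntegralRep 5), N.domain = {x | ∀ i, x i ∈ Set.Ioo (0:ℝ) 1} → N.IsRational → N'.domain = {x | ∀ i, x i ∈ Set.Ioo (0:ℝ) 1} → N'.IsRational → N.value = N'.value → Equivalent N N') :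
    ∀ (N : IntegralRep 2) (N' : IntegralRep 4), N.domain = {x | ∀ i, x i ∈ Set.Ioo (0:ℝ) 1} → N.IsRational → N'.domain = {x | ∀ i, x i ∈ Set.Ioo (0:ℝ) 1} → N'.IsRational → N.value = N'.value → Equivalent N N' :=
  fun N N' => stub_boxRigidity_var2252_iff_le_five.1 h 2 4 N N' (by norm_num) (by norm_num)

/-- **The parent leaf ⇒ V2252** (the variant is a specialisation of `stub_boxRigidity`; the converse
is not claimed — the parent is BoxVanishing in ALL dimensions, the variant only in dimension `5`).
[cite: KontsevichZagier2001, §1.2 Conjecture 1] -/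
theorem stub_boxRigidity_var2252_of_parent
    (h : ∀ (m m' : ℕ) (N : IntegralRep m) (N' : IntegralRep m'), N.domain = {x | ∀ i, x i ∈ Set.Ioo (0:ℝ) 1} → N.IsRational → N'.domain = {x | ∀ i, x i ∈ Set.Ioo (0:ℝ) 1} → N'.IsRational → N.value = N'.value → Equivalent N N') :
    ∀ (N : IntegralRep 3) (N' : IntegralRep 5), N.domain = {x | ∀ i, x i ∈ Set.Ioo (0:ℝ) 1} → N.IsRational → N'.domain = {x | ∀ i, x i ∈ Set.Ioo (0:ℝ) 1} → N'.IsRational → N.value = N'.value → Equivalent N N' :=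
  h 3 5

/-- **`KontsevichZagierPeriods ⇒ V2252`**: the variant is a special case of Conjecture 1 for the
tree's calculus — so a refutation of the variant would refute the Summit.
[cite: KontsevichZagier2001, §1.2 Conjecture 1] -/
theorem stub_boxRigidity_var2252_of_statement (h : _root_.KontsevichZagierPeriods) :
    ∀ (N : IntegralRep 3) (N' : IntegralRep 5), N.domain = {x | ∀ i, x i ∈ Set.Ioo (0:ℝ) 1} → N.IsRational → N'.domain = {x | ∀ i, x i ∈ Set.Ioo (0:ℝ) 1} → N'.IsRational → N.value = N'.value → Equivalent N N' :=
  (leaves_of_statement h).1 3 5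

end Summit.KontsevichZagierPeriods.KontsevichZagierPeriods.Theorems

end
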